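import Summits.ResolutionOfSingularities.ResolutionOfSingularities.Theorems.UniversalCellsCampaignW82DifferentialCriterionScheme
import Summits.ResolutionOfSingularities.ResolutionOfSingularities.Theorems.UniversalCellsCampaignW82FrobeniusTwistProofs
import Literature.AlgebraicGeometry.HodgeTheory.AlgebraicityLocusCurves
import Mathlib.AlgebraicGeometry.Noetherian
import HarnessLib

/-!
# [OURS · L1 W8.2] The residual of slot W8.2 in 1-FORM form, by name: «a REGULAR model of some Frobenius twist on
# which the 1-form `dt` vanishes nowhere» in place of «a SMOOTH model of some Frobenius twist»

Cell `res-hironaka` (run/shared/lean/pub/res-hironaka/), LADDER-RESOLUTION rung L (RESCUE), slot W8.2; host route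
`UniversalCells`, host item `PrimeFieldToPerfect` (stmt-ResolutionOfSingularities-15233), door 1. Links file
(Theses-free: imports only the Theses-free campaign modules `…FrobeniusTwistGraded/Proofs`, the (E6) scheme form
`…DifferentialCriterionScheme`, and the tree's `locallyOfFinitePresentation_of_isLocallyNoetherian`), written by
res-L1-s82-pv-1 (gen 7).

* `hasSmoothFrobeniusTwistModel_iff_oneForm` — for every PERFECT field `M` of characteristic `p` and every
  `f₀ : X₀ ⟶ Spec M(t)` locally of finite type: `HasSmoothFrobeniusTwistModel p M(t) f₀` (gen 2: some Frobenius twist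
  `X₀^{(p^e)}` has a SMOOTH proper birational model `Y`) ⟺ some twist has a proper birational model `Y` which is a
  REGULAR scheme on which `dt(y) ≠ 0` at every point `y` (`dt(y) = 1 ⊗ d(t) ∈ κ(y) ⊗ Ω_{𝒪_{Y,y}/M}`, the germ of
  the 1-form `dt` of the constants `t ∈ M(t)` over `M`).
* `frobeniusTwistStepAt_iff_oneFormStep` / `perfectionStepAt_iff_oneFormStep` — the residual of slot W8.2
  (`FrobeniusTwistStepAt p M n` ≡ `PerfectionStepAt M n`, `M` perfect) in 1-form form: granted resolution in
  dimension `≤ n` over `M(t)`, every admissible `X₀` of dimension `≤ n` has a level `e` and a RESOLUTION `Y` of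
  `X₀^{(p^e)}` (regular, proper birational) ON WHICH `dt` VANISHES NOWHERE.

READING. Of the six normal forms (E1)–(E6) of Cruxes/PrimeFieldToPerfect/KERNEL.md §2 this is the one that names an
INVARIANT of a resolution `Y → X₀^{(p^e)}`: the zero scheme `Z(dt) ⊂ Y` of one global section of the locally free
sheaf `Ω_{Y/M}` (rank `dim Y + 1`), which is exactly the non-smooth locus; the residual asks to make `Z(dt)` empty
for some `e` by the choice of `Y`. (Blowing up `Y` further in regular centres inside `Z(dt)` changes `Z(dt)`; no
termination measure is claimed here.) A normal form, not progress on the open residual (`n ≥ 4`).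

HONEST FRAMING. OURS theorems; NOT statements of [Hironaka2017]; nothing attributed to its author. AI work, weaker
than expert review; no claim beyond the kernel. No `sorry`, no new axioms.
-/

noncomputable section

set_option linter.dupNamespace false -- mandated namespace of this single-conjunct summit

open CategoryTheory CategoryTheory.Limits AlgebraicGeometry TopologicalSpace TensorProduct IsLocalRing
open scoped RatFunc
open Literature.AlgebraicGeometry.Resolution

namespace Summit.ResolutionOfSingularities.ResolutionOfSingularities.Theorems.CampaignW82

universe u

/-! ## `HasSmoothFrobeniusTwistModel` in 1-form form -/

/-- **A smooth model of a Frobenius twist = a regular model of a twist on which `dt` vanishes nowhere** (`M` PERFECT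
of characteristic `p`, `f₀` locally of finite type): `HasSmoothFrobeniusTwistModel p M(t) f₀` iff for some `e` the
twist `X₀^{(p^e)}` has a proper birational model `Y` that is a regular scheme with `dt(y) ≠ 0` for every `y ∈ Y`
(`𝒪_{Y,y}` an `M(t)`- and `M`-algebra through the constants of `Y → X₀^{(p^e)} → Spec M(t)`).
[cite: EGA0IV, Thm. 20.5.7] -/
theorem hasSmoothFrobeniusTwistModel_iff_oneForm (p : ℕ) [Fact p.Prime] (M : Type u) [Field M] [CharP M p]
    [PerfectField M] {X₀ : Scheme.{u}} (f₀ : X₀ ⟶ Spec (.of (RatFunc M))) [LocallyOfFiniteType f₀] :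
    HasSmoothFrobeniusTwistModel p (RatFunc M) f₀ ↔
      ∃ (e : ℕ) (Y : Scheme.{u})
        (π : Y ⟶ pullback f₀ (Spec.map (CommRingCat.ofHom (iterateFrobenius (RatFunc M) p e)))),
        IsProper π ∧ IsBirational π ∧ Scheme.IsRegular Y ∧
          ∀ y : Y,
            letI q := π ≫ pullback.snd f₀ (Spec.map (CommRingCat.ofHom (iterateFrobenius (RatFunc M) p e)))
            letI φ := ((Scheme.ΓSpecIso (.of (RatFunc M))).inv ≫ q.appTop ≫ Y.presheaf.germ ⊤ y trivial).hom
            letI : Algebra (RatFunc M) (Y.presheaf.stalk y) := φ.toAlgebra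
            letI : Algebra M (Y.presheaf.stalk y) := (φ.comp (algebraMap M (RatFunc M))).toAlgebra
            (1 : ResidueField (Y.presheaf.stalk y)) ⊗ₜ[Y.presheaf.stalk y]
              KaehlerDifferential.D M (Y.presheaf.stalk y) (φ RatFunc.X) ≠ 0 := by
  unfold HasSmoothFrobeniusTwistModel
  refine exists_congr fun e => exists_congr fun Y => exists_congr fun π => ?_
  -- the structure map `q : Y → Spec M(t)` of the model is locally of finite presentation
  haveI : LocallyOfFiniteType
      (pullback.snd f₀ (Spec.map (CommRingCat.ofHom (iterateFrobenius (RatFunc M) p e)))) :=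
    MorphismProperty.pullback_snd _ _ inferInstance
  constructor
  · rintro ⟨hp, hb, hsm⟩
    haveI := hp
    haveI : LocallyOfFinitePresentation
        (π ≫ pullback.snd f₀ (Spec.map (CommRingCat.ofHom (iterateFrobenius (RatFunc M) p e)))) :=
      Literature.AlgebraicGeometry.HodgeTheory.locallyOfFinitePresentation_of_isLocallyNoetherian _
    exact ⟨hp, hb, (smooth_iff_isRegular_and_forall_tmul_D_ne_zero
      (π ≫ pullback.snd f₀ (Spec.map (CommRingCat.ofHom (iterateFrobenius (RatFunc M) p e))))).mp hsm⟩
  · rintro ⟨hp, hb, hreg, h⟩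
    haveI := hp
    haveI : LocallyOfFinitePresentation
        (π ≫ pullback.snd f₀ (Spec.map (CommRingCat.ofHom (iterateFrobenius (RatFunc M) p e)))) :=
      Literature.AlgebraicGeometry.HodgeTheory.locallyOfFinitePresentation_of_isLocallyNoetherian _
    exact ⟨hp, hb, (smooth_iff_isRegular_and_forall_tmul_D_ne_zero
      (π ≫ pullback.snd f₀ (Spec.map (CommRingCat.ofHom (iterateFrobenius (RatFunc M) p e))))).mpr ⟨hreg, h⟩⟩

/-! ## The residual of slot W8.2 in 1-form form -/

/-- **The Frobenius-twist step in 1-FORM form** (`M` PERFECT of characteristic `p`, every grade `n`):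
`FrobeniusTwistStepAt p M n` iff, granted resolution of integral separated finite-type schemes of dimension `≤ n`
over `M(t)`, every separated finite-type `X₀/M(t)` of dimension `≤ n` integral over the perfect closure has a
level `e` and a proper birational REGULAR model `Y` of `X₀^{(p^e)}` on which the 1-form `dt` vanishes nowhere.
[cite: EGA0IV, Thm. 20.5.7] -/
theorem frobeniusTwistStepAt_iff_oneFormStep (p : ℕ) [Fact p.Prime] (M : Type) [Field M] [CharP M p]
    [PerfectField M] (n : WithBot ℕ∞) :
    FrobeniusTwistStepAt p M n ↔
      ((∀ (X : Scheme.{0}) (f : X ⟶ Spec (.of (RatFunc M))),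
          IsSeparated f → LocallyOfFiniteType f → QuasiCompact f → IsIntegral X →
            topologicalKrullDim X ≤ n → Scheme.HasResolution X) →
        ∀ (X₀ : Scheme.{0}) (f₀ : X₀ ⟶ Spec (.of (RatFunc M))),
          IsSeparated f₀ → LocallyOfFiniteType f₀ → QuasiCompact f₀ → topologicalKrullDim X₀ ≤ n →
            IntegralOverPerfectClosure (RatFunc M) f₀ →
            ∃ (e : ℕ) (Y : Scheme.{0})
              (π : Y ⟶ pullback f₀ (Spec.map (CommRingCat.ofHom (iterateFrobenius (RatFunc M) p e)))),
              IsProper π ∧ IsBirational π ∧ Scheme.IsRegular Y ∧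
                ∀ y : Y,
                  letI q := π ≫ pullback.snd f₀ (Spec.map (CommRingCat.ofHom (iterateFrobenius (RatFunc M) p e)))
                  letI φ :=
                    ((Scheme.ΓSpecIso (.of (RatFunc M))).inv ≫ q.appTop ≫ Y.presheaf.germ ⊤ y trivial).hom
                  letI : Algebra (RatFunc M) (Y.presheaf.stalk y) := φ.toAlgebra
                  letI : Algebra M (Y.presheaf.stalk y) := (φ.comp (algebraMap M (RatFunc M))).toAlgebra
                  (1 : ResidueField (Y.presheaf.stalk y)) ⊗ₜ[Y.presheaf.stalk y]
                    KaehlerDifferential.D M (Y.presheaf.stalk y) (φ RatFunc.X) ≠ 0) := by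
  refine ⟨fun h hres X₀ f₀ hs hl hq hd hint => ?_, fun h hres X₀ f₀ hs hl hq hd hint => ?_⟩
  · haveI := hl
    exact (hasSmoothFrobeniusTwistModel_iff_oneForm p M f₀).mp (h hres X₀ f₀ hs hl hq hd hint)
  · haveI := hl
    exact (hasSmoothFrobeniusTwistModel_iff_oneForm p M f₀).mpr (h hres X₀ f₀ hs hl hq hd hint)

/-- **The perfection step (the W8.2 residual of record) in 1-FORM form** (`M` PERFECT of characteristic `p`, every
grade): through `perfectionStepAt_iff_frobeniusTwistStepAt` (gen 2). [cite: EGA0IV, Thm. 20.5.7] -/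
theorem perfectionStepAt_iff_oneFormStep (p : ℕ) [Fact p.Prime] (M : Type) [Field M] [CharP M p]
    [PerfectField M] (n : WithBot ℕ∞) :
    PerfectionStepAt M n ↔
      ((∀ (X : Scheme.{0}) (f : X ⟶ Spec (.of (RatFunc M))),
          IsSeparated f → LocallyOfFiniteType f → QuasiCompact f → IsIntegral X →
            topologicalKrullDim X ≤ n → Scheme.HasResolution X) →
        ∀ (X₀ : Scheme.{0}) (f₀ : X₀ ⟶ Spec (.of (RatFunc M))),
          IsSeparated f₀ → LocallyOfFiniteType f₀ → QuasiCompact f₀ → topologicalKrullDim X₀ ≤ n →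
            IntegralOverPerfectClosure (RatFunc M) f₀ →
            ∃ (e : ℕ) (Y : Scheme.{0})
              (π : Y ⟶ pullback f₀ (Spec.map (CommRingCat.ofHom (iterateFrobenius (RatFunc M) p e)))),
              IsProper π ∧ IsBirational π ∧ Scheme.IsRegular Y ∧
                ∀ y : Y,
                  letI q := π ≫ pullback.snd f₀ (Spec.map (CommRingCat.ofHom (iterateFrobenius (RatFunc M) p e)))
                  letI φ :=
                    ((Scheme.ΓSpecIso (.of (RatFunc M))).inv ≫ q.appTop ≫ Y.presheaf.germ ⊤ y trivial).hom
                  letI : Algebra (RatFunc M) (Y.presheaf.stalk y) := φ.toAlgebra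
                  letI : Algebra M (Y.presheaf.stalk y) := (φ.comp (algebraMap M (RatFunc M))).toAlgebra
                  (1 : ResidueField (Y.presheaf.stalk y)) ⊗ₜ[Y.presheaf.stalk y]
                    KaehlerDifferential.D M (Y.presheaf.stalk y) (φ RatFunc.X) ≠ 0) :=
  (perfectionStepAt_iff_frobeniusTwistStepAt p M n).trans (frobeniusTwistStepAt_iff_oneFormStep p M n)

end Summit.ResolutionOfSingularities.ResolutionOfSingularities.Theorems.CampaignW82
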